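import Summits.AtomisticToContinuum.HydrodynamicLimit.Theorems.CollisionIsometryCLTMacroClosureEngineDefs
import HarnessLib

/-!
# Sub-goal `engine_goodEvent` of the stub `stub_engine` (line `IdeatorTwoGen1Sketch`, crux `MacroClosure`,
# stmt-AtomisticToContinuum-14870): the good event of the barycentric Gronwall

From the instantiated conclusions of the a-priori bounds APS (i) (exponential velocity moments), APS (ii)
(block densities in the band), the fast moment relaxation FMR (kinetic closure defects) and the collisional
transfer locality CTL (collisional residual), each an in-probability statement along one flow family `Φ`,
one kernel family `φ` and one time `t` under the local Gibbs laws `P_N`, we build measurable good events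
`G_N ⊆ good` with `P_N(G_Nᶜ) → 0` and a diagonal tolerance `δ_N → 0`, `δ_N > 0`, on which all four bounds
hold SURELY.

Proof. (1) A diagonal lemma (`GoodEvent.exists_diagonal`): if `a_N(δ) → 0` for every `δ > 0` then there is
a positive `δ_N → 0` with `a_N(δ_N) → 0` (thresholds `M_k` with `a_N(1/(k+1)) ≤ 1/(k+1)` for `N ≥ M_k`,
and `δ_N = 1/(K_N+1)` with `K_N` the largest `k ≤ N` with `M_k ≤ N`, via `Nat.findGreatest`). (2) A
measurable hull (`toMeasurable`) of the union of the four bad events, removed from the good set of the flow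
(`GoodEvent.exists_goodEvent`, abstract). (3) `P_N(goodᶜ) = 0` since the local Gibbs law is absolutely
continuous with respect to the Liouville measure. No normalisation of `P_N` is needed.
-/

noncomputable section

open MeasureTheory Filter Set Topology InformationTheory
open scoped ENNReal ContDiff

namespace Summit.AtomisticToContinuum.HydrodynamicLimit.Theorems.MacroClosureLine

open Literature.MathematicalPhysics.KineticTheory Literature.Analysis.FluidPDE
open Literature.Analysis.FunctionSpaces

namespace Barycentric

namespace GoodEvent

/-- DIAGONAL LEMMA: if `a_N(δ) → 0` (in `ℝ≥0∞`) for every `δ > 0`, then along some positive sequence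
`δ_N → 0` one still has `a_N(δ_N) → 0`. No monotonicity in `δ` is needed. -/
theorem exists_diagonal {a : ℕ → ℝ → ℝ≥0∞}
    (ha : ∀ δ : ℝ, 0 < δ → Tendsto (fun N => a N δ) atTop (𝓝 0)) :
    ∃ δs : ℕ → ℝ, (∀ N, 0 < δs N) ∧ Tendsto δs atTop (𝓝 0) ∧
      Tendsto (fun N => a N (δs N)) atTop (𝓝 0) := by
  -- thresholds `M k`: for `N ≥ M k`, `a N (1/(k+1)) ≤ 1/(k+1)`
  have hM : ∀ k : ℕ, ∃ M : ℕ, ∀ N ≥ M,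
      a N (1 / ((k : ℝ) + 1)) ≤ ENNReal.ofReal (1 / ((k : ℝ) + 1)) := fun k =>
    ENNReal.tendsto_atTop_zero.1 (ha _ Nat.one_div_pos_of_nat) _
      (ENNReal.ofReal_pos.2 Nat.one_div_pos_of_nat)
  choose M hM using hM
  -- `K N`: the largest `k ≤ N` with `M k ≤ N`
  set K : ℕ → ℕ := fun N => Nat.findGreatest (fun k => M k ≤ N) N with hK
  have hKtop : Tendsto K atTop atTop := by
    refine tendsto_atTop_atTop.2 fun k => ⟨max k (M k), fun N hN => ?_⟩
    exact Nat.le_findGreatest ((le_max_left _ _).trans hN) ((le_max_right _ _).trans hN)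
  have hKspec : ∀ N, M 0 ≤ N → M (K N) ≤ N := fun N hN =>
    Nat.findGreatest_spec (P := fun k => M k ≤ N) (Nat.zero_le N) hN
  have hδ0 : Tendsto (fun N => 1 / ((K N : ℝ) + 1)) atTop (𝓝 0) :=
    (tendsto_one_div_add_atTop_nhds_zero_nat (𝕜 := ℝ)).comp hKtop
  refine ⟨fun N => 1 / ((K N : ℝ) + 1), fun N => Nat.one_div_pos_of_nat, hδ0, ?_⟩
  have h0 : Tendsto (fun N => ENNReal.ofReal (1 / ((K N : ℝ) + 1))) atTop (𝓝 0) := by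
    rw [← ENNReal.ofReal_zero]
    exact ENNReal.tendsto_ofReal hδ0
  refine tendsto_of_tendsto_of_tendsto_of_le_of_le' tendsto_const_nhds h0
    (Eventually.of_forall fun _ => zero_le) ?_
  filter_upwards [eventually_ge_atTop (M 0)] with N hN
  exact hM (K N) N (hKspec N hN)

variable {Ω : ℕ → Type*} [∀ N, MeasurableSpace (Ω N)]

/-- ABSTRACT GOOD EVENT: given laws `P_N`, conull measurable good sets, two bad events of probability `→ 0`
and two `δ`-indexed families of bad events of probability `→ 0` for every `δ > 0`, there are measurable
`G_N ⊆ good_N` with `P_N(G_Nᶜ) → 0` and a positive `δ_N → 0` such that `G_N` avoids all four bad events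
(the `δ`-indexed ones at `δ = δ_N`). -/
theorem exists_goodEvent (P : (N : ℕ) → Measure (Ω N)) (good : (N : ℕ) → Set (Ω N))
    (B₁ B₂ : (N : ℕ) → Set (Ω N)) (B₃ B₄ : (N : ℕ) → ℝ → Set (Ω N))
    (hgm : ∀ N, MeasurableSet (good N)) (hg0 : ∀ N, P N (good N)ᶜ = 0)
    (h₁ : Tendsto (fun N => P N (B₁ N)) atTop (𝓝 0))
    (h₂ : Tendsto (fun N => P N (B₂ N)) atTop (𝓝 0))
    (h₃ : ∀ δ : ℝ, 0 < δ → Tendsto (fun N => P N (B₃ N δ)) atTop (𝓝 0))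
    (h₄ : ∀ δ : ℝ, 0 < δ → Tendsto (fun N => P N (B₄ N δ)) atTop (𝓝 0)) :
    ∃ (G : (N : ℕ) → Set (Ω N)) (δs : ℕ → ℝ), (∀ N, 0 < δs N) ∧ Tendsto δs atTop (𝓝 0) ∧
      (∀ N, MeasurableSet (G N)) ∧ (∀ N, G N ⊆ good N) ∧
      Tendsto (fun N => P N (G N)ᶜ) atTop (𝓝 0) ∧
      ∀ N, ∀ z ∈ G N, z ∉ B₁ N ∧ z ∉ B₂ N ∧ z ∉ B₃ N (δs N) ∧ z ∉ B₄ N (δs N) := by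
  -- diagonal tolerance for the sum of the two `δ`-indexed bad probabilities
  obtain ⟨δs, hδpos, hδ0, h34⟩ := exists_diagonal (a := fun N δ => P N (B₃ N δ) + P N (B₄ N δ))
    fun δ hδ => by simpa using (h₃ δ hδ).add (h₄ δ hδ)
  -- the bad event and its measurable hull
  set Bad : (N : ℕ) → Set (Ω N) := fun N => B₁ N ∪ B₂ N ∪ (B₃ N (δs N) ∪ B₄ N (δs N)) with hBad
  set B' : (N : ℕ) → Set (Ω N) := fun N => toMeasurable (P N) (Bad N) with hB'
  refine ⟨fun N => good N ∩ (B' N)ᶜ, δs, hδpos, hδ0,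
    fun N => (hgm N).inter (measurableSet_toMeasurable _ _).compl, fun N => inter_subset_left, ?_, ?_⟩
  · -- `P (G N)ᶜ ≤ P goodᶜ + P (Bad N) ≤ 0 + (P B₁ + P B₂ + (P B₃ + P B₄)) → 0`
    have hle : ∀ N, P N (good N ∩ (B' N)ᶜ)ᶜ ≤
        0 + (P N (B₁ N) + P N (B₂ N) + (P N (B₃ N (δs N)) + P N (B₄ N (δs N)))) := by
      intro N
      rw [compl_inter, compl_compl]
      refine (measure_union_le _ _).trans (add_le_add (hg0 N).le ?_)
      rw [hB', measure_toMeasurable]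
      exact (measure_union_le _ _).trans
        (add_le_add ((measure_union_le _ _).trans le_rfl) (measure_union_le _ _))
    have hlim : Tendsto (fun N => (0 : ℝ≥0∞) +
        (P N (B₁ N) + P N (B₂ N) + (P N (B₃ N (δs N)) + P N (B₄ N (δs N))))) atTop (𝓝 0) := by
      simpa using (h₁.add h₂).add h34
    exact tendsto_of_tendsto_of_tendsto_of_le_of_le tendsto_const_nhds hlim (fun _ => zero_le) hle
  · intro N z hz
    have hzB : z ∉ Bad N := fun h => hz.2 (subset_toMeasurable (P N) (Bad N) h)
    simp only [hBad, mem_union, not_or] at hzB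
    exact ⟨hzB.1.1, hzB.1.2, hzB.2.1, hzB.2.2⟩

end GoodEvent

/-- The local Gibbs law charges only good configurations of the flow (it is absolutely continuous with
respect to the Liouville measure, for which the good set is conull). -/
theorem localGibbsLaw_compl_good (σ : ℝ) (a₀ θ₀ : T3 → ℝ) (u₀ : T3 → V3) (N : ℕ) (Φ : Flow σ N) :
    localGibbsLaw σ a₀ u₀ θ₀ N Φ (Φ.good)ᶜ = 0 := by
  rw [localGibbsLaw_eq]
  exact localGibbsMeasure_absolutelyContinuous σ a₀ u₀ θ₀ N Φ Φ.measure_compl_good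

/-- S1 GOOD EVENT: from the instantiated conclusions of APS (i), (ii), FMR and CTL (at the tests `(lamM, lamE)`)
along one flow family and one kernel family, a family of measurable good events `G_N ⊆ good` of probability
`→ 1` and a diagonal tolerance `δ_N ↓ 0` on which all four bounds hold SURELY. -/
theorem engine_goodEvent : ∀ (σ : ℝ) (a₀ θ₀ : T3 → ℝ) (u₀ : T3 → V3), Continuous a₀ → Continuous θ₀ →
    Continuous u₀ → (∀ x, 0 < a₀ x) → (∀ x, 0 < θ₀ x) → 0 < σ → σ ≤ 1 / 2 →
    ∀ (θ : ℝ → T3 → ℝ) (u : ℝ → T3 → V3) (Φ : (N : ℕ) → Flow σ N) (φ : ℕ → T3 → ℝ) (t : ℝ),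
    (∃ lam Cexp : ℝ, 0 < lam ∧ Tendsto (fun N : ℕ => localGibbsLaw σ a₀ u₀ θ₀ N (Φ N)
      {z | Cexp < ∫ s in Icc 0 t, ∫ y, Real.exp (lam * ‖y.2‖ ^ 2) ∂(empiricalMeasure ((Φ N).flow s z))})
      atTop (𝓝 0)) →
    (∃ c₁ : ℝ, 0 < c₁ ∧ Tendsto (fun N : ℕ => localGibbsLaw σ a₀ u₀ θ₀ N (Φ N)
      {z | ∃ s ∈ Icc 0 t, ∃ x : T3, bρ (φ N) ((Φ N).flow s z) x < c₁ ∨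
        1 < bρ (φ N) ((Φ N).flow s z) x * σ ^ 3}) atTop (𝓝 0)) →
    (∀ δ : ℝ, 0 < δ → Tendsto (fun N : ℕ => localGibbsLaw σ a₀ u₀ θ₀ N (Φ N)
      {z | δ < ∫ s in Icc 0 t, ∫ x, ((∑ j, ∑ k, bD (φ N) ((Φ N).flow s z) x j k ^ 2) +
        ‖bq (φ N) ((Φ N).flow s z) x‖ ^ 2)}) atTop (𝓝 0)) →
    (∀ δ : ℝ, 0 < δ → Tendsto (fun N : ℕ => localGibbsLaw σ a₀ u₀ θ₀ N (Φ N)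
      {z | ∃ τ ∈ Icc 0 t, δ < |ccRes θ u (Φ N) z τ -
        ∫ s in Icc 0 τ, ∫ x, ccClosure σ θ u (φ N) s ((Φ N).flow s z) x|}) atTop (𝓝 0)) →
    ∃ (G : (N : ℕ) → Set (Config (N + 1) (Fin 3) T3)) (δs : ℕ → ℝ) (lam Cexp c₁ : ℝ),
      0 < lam ∧ 0 < c₁ ∧ (∀ N, 0 < δs N) ∧ Tendsto δs atTop (𝓝 0) ∧ (∀ N, MeasurableSet (G N)) ∧
      (∀ N, G N ⊆ (Φ N).good) ∧
      Tendsto (fun N : ℕ => localGibbsLaw σ a₀ u₀ θ₀ N (Φ N) (G N)ᶜ) atTop (𝓝 0) ∧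
      ∀ N, ∀ z ∈ G N,
        (∫ s in Icc 0 t, ∫ y, Real.exp (lam * ‖y.2‖ ^ 2) ∂(empiricalMeasure ((Φ N).flow s z)) ≤ Cexp) ∧
        (∀ s ∈ Icc 0 t, ∀ x, c₁ ≤ bρ (φ N) ((Φ N).flow s z) x ∧ bρ (φ N) ((Φ N).flow s z) x * σ ^ 3 ≤ 1) ∧
        (∫ s in Icc 0 t, ∫ x, ((∑ j, ∑ k, bD (φ N) ((Φ N).flow s z) x j k ^ 2) +
          ‖bq (φ N) ((Φ N).flow s z) x‖ ^ 2) ≤ δs N) ∧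
        (∀ τ ∈ Icc 0 t, |ccRes θ u (Φ N) z τ -
          ∫ s in Icc 0 τ, ∫ x, ccClosure σ θ u (φ N) s ((Φ N).flow s z) x| ≤ δs N) := by
  intro σ a₀ θ₀ u₀ _ _ _ _ _ _ _ θ u Φ φ t hA hB hF hC
  obtain ⟨lam, Cexp, hlam, hA⟩ := hA
  obtain ⟨c₁, hc₁, hB⟩ := hB
  obtain ⟨G, δs, hδpos, hδ0, hGm, hGg, hGc, hGz⟩ :=
    GoodEvent.exists_goodEvent (fun N => localGibbsLaw σ a₀ u₀ θ₀ N (Φ N)) (fun N => (Φ N).good)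
      (fun N => {z | Cexp < ∫ s in Icc 0 t, ∫ y, Real.exp (lam * ‖y.2‖ ^ 2)
        ∂(empiricalMeasure ((Φ N).flow s z))})
      (fun N => {z | ∃ s ∈ Icc 0 t, ∃ x : T3, bρ (φ N) ((Φ N).flow s z) x < c₁ ∨
        1 < bρ (φ N) ((Φ N).flow s z) x * σ ^ 3})
      (fun N δ => {z | δ < ∫ s in Icc 0 t, ∫ x, ((∑ j, ∑ k, bD (φ N) ((Φ N).flow s z) x j k ^ 2) +
        ‖bq (φ N) ((Φ N).flow s z) x‖ ^ 2)})
      (fun N δ => {z | ∃ τ ∈ Icc 0 t, δ < |ccRes θ u (Φ N) z τ -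
        ∫ s in Icc 0 τ, ∫ x, ccClosure σ θ u (φ N) s ((Φ N).flow s z) x|})
      (fun N => (Φ N).measurableSet_good) (fun N => localGibbsLaw_compl_good σ a₀ θ₀ u₀ N (Φ N))
      hA hB hF hC
  refine ⟨G, δs, lam, Cexp, c₁, hlam, hc₁, hδpos, hδ0, hGm, hGg, hGc, fun N z hz => ?_⟩
  obtain ⟨h1, h2, h3, h4⟩ := hGz N z hz
  simp only [mem_setOf_eq, not_lt, not_exists, not_or, not_and] at h1 h2 h3 h4
  exact ⟨h1, fun s hs x => ⟨(h2 s hs x).1, (h2 s hs x).2⟩, h3, h4⟩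

end Barycentric

end Summit.AtomisticToContinuum.HydrodynamicLimit.Theorems.MacroClosureLine

end
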